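import Summits.CriticalPhenomena.Ising3DConformalLimit.Theses.IsingEuclidUpgrade
import Summits.CriticalPhenomena.Ising3DConformalLimit.Theorems.BernsteinTemperatureKernelTransferStep
import Literature.Probability.LatticeModels.PointwiseScalingLimitEtaExists
import Literature.Probability.LatticeModels.CriticalTwoPointLawDimension
import HarnessLib

/-!
# Crux `IsingEuclidUpgradeR2RotInvPowerLaw` (stmt-CriticalPhenomena-0634), line `tower_profile_rigidity`:
# the lossless split AXIS × ANGLE (`IsingEuclidUpgradeR2RotInvPowerLaw_of_subs`, `rotInvPowerLaw_iff_subs`)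

Write `G := criticalTwoPoint 3` for the critical two-point function `⟨σ₀σ_x⟩_{β_c}` of the
nearest-neighbour Ising model on `ℤ³`, `g(n) := G(n e₀)`, `|x|₂ := √(∑ xᵢ²)` and `N(x) := ⌊|x|₂⌋`.
The crux r2 (`Theses.IsingEuclidUpgrade.IsingEuclidUpgradeR2RotInvPowerLaw`) reads
`∃ Δ c > 0, G(x)·|x|₂^{2Δ} → c` along the cofinite filter of `ℤ³`.

**Theorems** (the two registered glue names of the line, verbatim).

* `IsingEuclidUpgradeR2RotInvPowerLaw_of_subs` : D1 → S3 → r2, where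
  D1 (axial pure power law) is `∃ Δ c > 0, g(n)·n^{2Δ} → c` (`n → ∞`) and
  S3 (ratio isotropy) is `G(x)/g(N x) → 1` cofinitely;
* `rotInvPowerLaw_iff_subs` : r2 ↔ D1 ∧ S3 (the split is LOSSLESS).

Proof. (D1 ∧ S3 ⇒ r2) `G(x)|x|₂^{2Δ} = (G(x)/g(N x)) · (g(N x)(N x)^{2Δ}) · (|x|₂/N x)^{2Δ} → 1·c·1`,
since `N x → ∞` and `N x/|x|₂ → 1` cofinitely. (r2 ⇒ D1) restrict the cofinite limit to the axis
`n ↦ n e₀`, an injective sequence (hence cofinitely divergent) with `|n e₀|₂ = n`. (r2 ⇒ S3)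
`G(x)/g(N x) = [G(x)|x|₂^{2Δ}] / [g(N x)(N x)^{2Δ}] · (N x/|x|₂)^{2Δ} → (c/c)·1 = 1`, the second
bracket converging to `c` by r2 ⇒ D1 composed with `N x → ∞`.

References: H. Duminil-Copin, ICM 2022, §8 (rotation invariance of the critical two-point function on
`ℤ³` is open) [DuminilCopinICM2022]; the manipulations here are folklore. No definitions are
introduced; the positivity `0 < g(n)` is the tree theorem `criticalTwoPoint_axis_pos`.
-/

noncomputable section

namespace Summit.CriticalPhenomena.Ising3DConformalLimit.Theorems.IsingEuclidUpgradeR2Split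

open Filter Topology Literature.Probability.LatticeModels
open Summit.CriticalPhenomena.Ising3DConformalLimit.Theorems.KernelTransfer (tendsto_sqrt_sum_sq_cofinite)

/-- **r2 at `(Δ, c)` ⇒ D1 at `(Δ, c)`.** Restricting the cofinite power law `G(x)|x|₂^{2Δ} → c` to the
axis `n ↦ n e₀` (injective, hence cofinitely divergent; `|n e₀|₂ = n`) gives `g(n) n^{2Δ} → c`.
[folklore] -/
theorem axis_tendsto_of_tendsto {Δ c : ℝ}
    (hT : Tendsto (fun x : Site 3 => criticalTwoPoint 3 x * Real.sqrt (∑ i, ((x i : ℝ)) ^ 2) ^ (2 * Δ))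
      cofinite (𝓝 c)) :
    Tendsto (fun n : ℕ => criticalTwoPoint 3 (Pi.single 0 ((n : ℕ) : ℤ)) * (n : ℝ) ^ (2 * Δ))
      atTop (𝓝 c) := by
  -- adapted from `DiffusiveBranchIsNonsaturation.stub_exponentWindow` (the axis step)
  refine (hT.comp tendsto_natCast_single_axis_cofinite).congr fun n => ?_
  simp only [Function.comp_apply]
  rw [sqrt_sum_sq_single_axis, Int.cast_natCast, Nat.abs_cast]

/-- **r2 ⇒ D1.** The rotation-invariant pure power law implies the axial pure power law (same
exponent, same constant). [folklore] -/
theorem axisPowerLaw_of_rotInvPowerLaw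
    (h : Summit.CriticalPhenomena.Ising3DConformalLimit.Theses.IsingEuclidUpgrade.IsingEuclidUpgradeR2RotInvPowerLaw) :
    ∃ Δ c : ℝ, 0 < c ∧ Filter.Tendsto (fun n : ℕ => Literature.Probability.LatticeModels.criticalTwoPoint 3 (Pi.single 0 ((n : ℕ) : ℤ)) * (n : ℝ) ^ (2 * Δ)) Filter.atTop (nhds c) := by
  obtain ⟨Δ, c, hc, hT⟩ := h
  exact ⟨Δ, c, hc, axis_tendsto_of_tendsto hT⟩

/-- **r2 ⇒ S3 (ratio isotropy).** With `N x := ⌊|x|₂⌋`: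
`G(x)/g(N x) = [G(x)|x|₂^{2Δ}] / [g(N x)(N x)^{2Δ}] · (N x/|x|₂)^{2Δ} → (c/c)·1 = 1`. [folklore] -/
theorem ratioIsotropy_of_rotInvPowerLaw
    (h : Summit.CriticalPhenomena.Ising3DConformalLimit.Theses.IsingEuclidUpgrade.IsingEuclidUpgradeR2RotInvPowerLaw) :
    Filter.Tendsto (fun x : Literature.Probability.LatticeModels.Site 3 => Literature.Probability.LatticeModels.criticalTwoPoint 3 x / Literature.Probability.LatticeModels.criticalTwoPoint 3 (Pi.single 0 ((⌊Real.sqrt (∑ i, ((x i : ℝ)) ^ 2)⌋₊ : ℕ) : ℤ))) Filter.cofinite (nhds 1) := by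
  obtain ⟨Δ, c, hc, hT⟩ := h
  -- notation
  set E : Site 3 → ℝ := fun x => Real.sqrt (∑ i, ((x i : ℝ)) ^ 2) with hE
  set N : Site 3 → ℕ := fun x => ⌊E x⌋₊ with hN
  set g : ℕ → ℝ := fun n => criticalTwoPoint 3 (Pi.single 0 ((n : ℕ) : ℤ)) with hg
  have gpos : ∀ n, 0 < g n := fun n => criticalTwoPoint_axis_pos n
  have hE_top : Tendsto E cofinite atTop := tendsto_sqrt_sum_sq_cofinite 3
  have hN_top : Tendsto N cofinite atTop := tendsto_nat_floor_atTop.comp hE_top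
  have haxis : Tendsto (fun n : ℕ => g n * (n : ℝ) ^ (2 * Δ)) atTop (𝓝 c) :=
    axis_tendsto_of_tendsto hT
  -- the three factors
  have hA : Tendsto (fun x => criticalTwoPoint 3 x * E x ^ (2 * Δ)) cofinite (𝓝 c) := hT
  have hB : Tendsto (fun x => g (N x) * ((N x : ℕ) : ℝ) ^ (2 * Δ)) cofinite (𝓝 c) :=
    haxis.comp hN_top
  have hC0 : Tendsto (fun x => ((N x : ℕ) : ℝ) / E x) cofinite (𝓝 1) :=
    (tendsto_nat_floor_div_atTop (R := ℝ)).comp hE_top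
  have hC : Tendsto (fun x => (((N x : ℕ) : ℝ) / E x) ^ (2 * Δ)) cofinite (𝓝 1) := by
    have h := hC0.rpow_const (p := 2 * Δ) (Or.inl one_ne_zero)
    simpa using h
  have hprod : Tendsto (fun x => (criticalTwoPoint 3 x * E x ^ (2 * Δ)) /
      (g (N x) * ((N x : ℕ) : ℝ) ^ (2 * Δ)) * (((N x : ℕ) : ℝ) / E x) ^ (2 * Δ)) cofinite (𝓝 1) := by
    have h := (hA.div hB hc.ne').mul hC
    rw [div_self hc.ne', one_mul] at h
    exact h
  -- eventually `N x ≥ 1`, where the product is the target function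
  have hev : ∀ᶠ x : Site 3 in cofinite, 1 ≤ N x := hN_top.eventually (eventually_ge_atTop 1)
  refine hprod.congr' ?_
  filter_upwards [hev] with x hx
  have hNpos : (0 : ℝ) < ((N x : ℕ) : ℝ) := by exact_mod_cast hx
  have hEpos : 0 < E x := hNpos.trans_le (Nat.floor_le (Real.sqrt_nonneg _))
  have hgN : g (N x) ≠ 0 := (gpos _).ne'
  have hEne : E x ^ (2 * Δ) ≠ 0 := (Real.rpow_pos_of_pos hEpos _).ne'
  have hNne : ((N x : ℕ) : ℝ) ^ (2 * Δ) ≠ 0 := (Real.rpow_pos_of_pos hNpos _).ne'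
  show _ = criticalTwoPoint 3 x / g (N x)
  rw [Real.div_rpow hNpos.le hEpos.le]
  field_simp

/-- **D1 ⇒ S3 ⇒ r2** (registered glue `IsingEuclidUpgradeR2RotInvPowerLaw_of_subs` of the split
AXIS × ANGLE). With `N x := ⌊|x|₂⌋`:
`G(x)|x|₂^{2Δ} = (G(x)/g(N x)) · (g(N x)(N x)^{2Δ}) · (|x|₂/N x)^{2Δ} → 1 · c · 1`.
[cite: DuminilCopinICM2022, §8] -/
theorem IsingEuclidUpgradeR2RotInvPowerLaw_of_subs : (∃ Δ c : ℝ, 0 < c ∧ Filter.Tendsto (fun n : ℕ => Literature.Probability.LatticeModels.criticalTwoPoint 3 (Pi.single 0 ((n : ℕ) : ℤ)) * (n : ℝ) ^ (2 * Δ)) Filter.atTop (nhds c)) → Filter.Tendsto (fun x : Literature.Probability.LatticeModels.Site 3 => Literature.Probability.LatticeModels.criticalTwoPoint 3 x / Literature.Probability.LatticeModels.criticalTwoPoint 3 (Pi.single 0 ((⌊Real.sqrt (∑ i, ((x i : ℝ)) ^ 2)⌋₊ : ℕ) : ℤ))) Filter.cofinite (nhds 1) → Summit.CriticalPhenomena.Ising3DConformalLimit.Theses.IsingEuclidUpgrade.IsingEuclidUpgradeR2RotInvPowerLaw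 := by
  -- adapted from the line skeleton's `rotInvPowerLaw_of_axisPowerLaw_of_ratioIsotropy` (seat s1 glue)
  intro hD1 hS3
  obtain ⟨Δ, c, hc, haxis⟩ := hD1
  refine ⟨Δ, c, hc, ?_⟩
  -- notation
  set E : Site 3 → ℝ := fun x => Real.sqrt (∑ i, ((x i : ℝ)) ^ 2) with hE
  set N : Site 3 → ℕ := fun x => ⌊E x⌋₊ with hN
  set g : ℕ → ℝ := fun n => criticalTwoPoint 3 (Pi.single 0 ((n : ℕ) : ℤ)) with hg
  have gpos : ∀ n, 0 < g n := fun n => criticalTwoPoint_axis_pos n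
  have hE_top : Tendsto E cofinite atTop := tendsto_sqrt_sum_sq_cofinite 3
  have hN_top : Tendsto N cofinite atTop := tendsto_nat_floor_atTop.comp hE_top
  -- the three factors
  have hA : Tendsto (fun x => criticalTwoPoint 3 x / g (N x)) cofinite (𝓝 1) := hS3
  have hB : Tendsto (fun x => g (N x) * ((N x : ℕ) : ℝ) ^ (2 * Δ)) cofinite (𝓝 c) := haxis.comp hN_top
  have hC0 : Tendsto (fun x => ((N x : ℕ) : ℝ) / E x) cofinite (𝓝 1) :=
    (tendsto_nat_floor_div_atTop (R := ℝ)).comp hE_top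
  have hC1 : Tendsto (fun x => E x / ((N x : ℕ) : ℝ)) cofinite (𝓝 1) := by
    have h := hC0.inv₀ one_ne_zero
    rw [inv_one] at h
    refine h.congr fun x => ?_
    simp only [inv_div]
  have hC : Tendsto (fun x => (E x / ((N x : ℕ) : ℝ)) ^ (2 * Δ)) cofinite (𝓝 1) := by
    have h := hC1.rpow_const (p := 2 * Δ) (Or.inl one_ne_zero)
    simpa using h
  have hprod : Tendsto (fun x => (criticalTwoPoint 3 x / g (N x)) * (g (N x) * ((N x : ℕ) : ℝ) ^ (2 * Δ)) *
      (E x / ((N x : ℕ) : ℝ)) ^ (2 * Δ)) cofinite (𝓝 c) := by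
    have h := (hA.mul hB).mul hC
    simpa using h
  -- eventually `N x ≥ 1`, where the product is the target function
  have hev : ∀ᶠ x : Site 3 in cofinite, 1 ≤ N x := hN_top.eventually (eventually_ge_atTop 1)
  refine hprod.congr' ?_
  filter_upwards [hev] with x hx
  have hNpos : (0 : ℝ) < ((N x : ℕ) : ℝ) := by exact_mod_cast hx
  have hEnn : 0 ≤ E x := Real.sqrt_nonneg _
  have hgN : g (N x) ≠ 0 := (gpos _).ne'
  have hsplit : E x ^ (2 * Δ) = ((N x : ℕ) : ℝ) ^ (2 * Δ) * (E x / ((N x : ℕ) : ℝ)) ^ (2 * Δ) := by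
    rw [← Real.mul_rpow hNpos.le (div_nonneg hEnn hNpos.le), mul_div_cancel₀ _ hNpos.ne']
  rw [hsplit]
  field_simp

/-- **r2 ⇔ D1 ∧ S3** (registered glue `rotInvPowerLaw_iff_subs`): the split AXIS × ANGLE of the
rotation-invariant pure power law into the axial pure power law and ratio isotropy is LOSSLESS.
[cite: DuminilCopinICM2022, §8] -/
theorem rotInvPowerLaw_iff_subs : Summit.CriticalPhenomena.Ising3DConformalLimit.Theses.IsingEuclidUpgrade.IsingEuclidUpgradeR2RotInvPowerLaw ↔ ((∃ Δ c : ℝ, 0 < c ∧ Filter.Tendsto (fun n : ℕ => Literature.Probability.LatticeModels.criticalTwoPoint 3 (Pi.single 0 ((n : ℕ) : ℤ)) * (n : ℝ) ^ (2 * Δ)) Filter.atTop (nhds c)) ∧ Filter.Tendsto (fun x : Literature.Probability.LatticeModels.Site 3 => Literature.Probability.LatticeModels.criticalTwoPoint 3 x / Literature.Probability.LatticeModels.criticalTwoPoint 3 (Pi.single 0 ((⌊Real.sqrt (∑ i, ((x i : ℝ)) ^ 2)⌋₊ : ℕ) : ℤ))) Filter.cofinite (nhds 1)) :=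
  ⟨fun h => ⟨axisPowerLaw_of_rotInvPowerLaw h, ratioIsotropy_of_rotInvPowerLaw h⟩,
    fun h => IsingEuclidUpgradeR2RotInvPowerLaw_of_subs h.1 h.2⟩

end Summit.CriticalPhenomena.Ising3DConformalLimit.Theorems.IsingEuclidUpgradeR2Split

end
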